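import Summits.AtomisticToContinuum.FouriersLaw.Theorems.BondHeatUncertaintyLightConeBondHeatGibbsByParts
import Summits.AtomisticToContinuum.FouriersLaw.Theorems.OddSectorIrreversibilityOddCorrectorDecayOneSite
import Summits.AtomisticToContinuum.FouriersLaw.Theorems.BondHeatUncertaintySubdiffusiveBondHeatGibbsPositionEighthMoment

/-!
# Static Gibbs moments for the bath-locality estimate: momentum moments of every order, exponential position moments

Support file for item `stmt-AtomisticToContinuum-9139` (`OddSectorIrreversibility.OddCorrectorDecay`), negative
side (static inputs of the bath-locality estimate). For the pinned chain and `T > 0`: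
* `pinnedChain_integral_momentum_pow_add_two_all` (all `k`), `pinnedChain_integral_momentum_even_pow_le` —
  the Gaussian recursion `∫ p_i^{k+2} e^{-H/T} = T(k+1) ∫ p_i^k e^{-H/T}` and `∫ p_i^{2j} e^{-H/T} ≤ (2j)! T^j ∫ e^{-H/T}`
  (every observable dominated by `C(1+H)^m` is integrable, `LightConeBondHeat.pinnedChain_integrable_mul_gibbsDensity_of_le_pow`);
* `pinnedChain_exp_mul_sq_mul_exp_neg_U_le`, `pinnedChain_lintegral_exp_mul_sq_mul_exp_neg_U_ne_top` — with a
  QUARTIC pinning `lam > 0` the one-site weight absorbs any Gaussian growth: `e^{κa²} e^{-U(a)/T} ≤ e^{κ²T/lam} e^{-ω₂a²/(2T)}`;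
* `pinnedChain_lintegral_exp_mul_coord_sq_le` — hence, by the `N`-uniform one-site domination
  `ChainVariation.pinnedChain_lintegral_coord_gibbsWeight_le`, `∫ e^{κ q_k²} e^{-H/T} ≤ C_κ ∫ e^{-H/T}` with
  `C_κ = ∫ e^{κa²} e^{-U(a)/T} da / ∫ e^{-U(a)/T} da < ∞`, uniformly in `N` and the site `k`.
-/

noncomputable section

open MeasureTheory Finset Set
open scoped ENNReal
open Literature.MathematicalPhysics.KineticTheory.HeatConduction
open Summit.AtomisticToContinuum.FouriersLaw.Theorems.SubdiffusiveBondHeat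
open Summit.AtomisticToContinuum.FouriersLaw.Theorems.LightConeBondHeat (pinnedChain_integrable_mul_gibbsDensity_of_le_pow)

namespace Summit.AtomisticToContinuum.FouriersLaw.Theorems.ChainVariation

variable {N : ℕ}

section Pinned

variable {ω₂ lam β : ℝ} (hω : 0 < ω₂) (hl : 0 ≤ lam) (hβ : 0 ≤ β) (γ : ℝ) (N : ℕ) {T : ℝ} (hT : 0 < T)
include hω hl hβ hT

omit hT in
/-- `|p_i|^k ≤ 2^k (1 + H)^k`. [folklore] -/
theorem pinnedChain_abs_momentum_pow_le_all (x : PhaseSpace N) (i : Fin N) (k : ℕ) :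
    |x.2 i ^ k| ≤ 2 ^ k * (1 + (pinnedChain ω₂ lam β γ).hamiltonian N x) ^ k := by
  rw [abs_pow, ← mul_pow]
  refine pow_le_pow_left₀ (abs_nonneg _) ?_ k
  have h := pinnedChain_harmonic_le_hamiltonian (ω₂ := ω₂) hl hβ γ N x
  have h1 : x.2 i ^ 2 / 2 ≤ ∑ k, x.2 k ^ 2 / 2 :=
    Finset.single_le_sum (f := fun k => x.2 k ^ 2 / 2) (fun k _ => by positivity) (Finset.mem_univ i)
  have h2 : 0 ≤ ∑ k, ω₂ * x.1 k ^ 2 / 2 := Finset.sum_nonneg fun k _ => by positivity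
  have hH0 := pinnedChain_hamiltonian_nonneg hω.le hl hβ γ N x
  nlinarith [sq_nonneg (|x.2 i| - 1), sq_abs (x.2 i), abs_nonneg (x.2 i)]

/-- `p_i^k e^{-H/T}` is integrable for every `k`. [folklore] -/
theorem pinnedChain_integrable_momentum_pow_mul_gibbsDensity_all (i : Fin N) (k : ℕ) :
    Integrable fun x => x.2 i ^ k * (pinnedChain ω₂ lam β γ).gibbsDensity N T x :=
  pinnedChain_integrable_mul_gibbsDensity_of_le_pow hω hl hβ γ N hT k (by fun_prop)
    (fun x => pinnedChain_abs_momentum_pow_le_all hω hl hβ γ N x i k)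

/-- **Gaussian recursion for all momentum moments**: `∫ p_i^{k+2} e^{-H/T} = T(k+1) ∫ p_i^k e^{-H/T}`.
[folklore] -/
theorem pinnedChain_integral_momentum_pow_add_two_all (i : Fin N) (k : ℕ) :
    ∫ x, x.2 i ^ (k + 2) * (pinnedChain ω₂ lam β γ).gibbsDensity N T x =
      T * (k + 1) * ∫ x, x.2 i ^ k * (pinnedChain ω₂ lam β γ).gibbsDensity N T x := by
  have hint : ∀ m : ℕ, Integrable fun x => x.2 i ^ m * (pinnedChain ω₂ lam β γ).gibbsDensity N T x :=
    fun m => pinnedChain_integrable_momentum_pow_mul_gibbsDensity_all hω hl hβ γ N hT i m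
  have e := integral_mul_eq_neg_of_hasLineDerivAt_of_integrable
    (F := fun x : PhaseSpace N => x.2 i ^ (k + 1))
    (F' := fun x : PhaseSpace N => ((k + 1 : ℕ) : ℝ) * x.2 i ^ (k + 1 - 1))
    (g := (pinnedChain ω₂ lam β γ).gibbsDensity N T)
    (g' := fun x => -(x.2 i / T) * (pinnedChain ω₂ lam β γ).gibbsDensity N T x)
    (v := ((0, Pi.single i 1) : PhaseSpace N)) ?_ ?_ ?_
    (fun x => hasLineDerivAt_momentum_pow (k + 1) x i)
    (fun x => (pinnedChain ω₂ lam β γ).hasLineDerivAt_gibbsDensity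
      ((pinnedChain ω₂ lam β γ).hasLineDerivAt_hamiltonian_unitP N x i))
  · have lhs : ∫ x, x.2 i ^ (k + 1) *
        (-(x.2 i / T) * (pinnedChain ω₂ lam β γ).gibbsDensity N T x) =
        -T⁻¹ * ∫ x, x.2 i ^ (k + 2) * (pinnedChain ω₂ lam β γ).gibbsDensity N T x := by
      rw [← integral_const_mul]
      refine integral_congr_ae (Filter.Eventually.of_forall fun x => ?_)
      ring
    have rhs : ∫ x, ((k + 1 : ℕ) : ℝ) * x.2 i ^ (k + 1 - 1) *
        (pinnedChain ω₂ lam β γ).gibbsDensity N T x =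
        ((k : ℝ) + 1) * ∫ x, x.2 i ^ k * (pinnedChain ω₂ lam β γ).gibbsDensity N T x := by
      rw [← integral_const_mul]
      refine integral_congr_ae (Filter.Eventually.of_forall fun x => ?_)
      simp only [Nat.add_sub_cancel, Nat.cast_add, Nat.cast_one]
      ring
    rw [lhs, rhs] at e
    have hTne : T ≠ 0 := hT.ne'
    have e2 : T⁻¹ * ∫ x, x.2 i ^ (k + 2) * (pinnedChain ω₂ lam β γ).gibbsDensity N T x =
        ((k : ℝ) + 1) * ∫ x, x.2 i ^ k * (pinnedChain ω₂ lam β γ).gibbsDensity N T x := by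
      linarith
    calc ∫ x, x.2 i ^ (k + 2) * (pinnedChain ω₂ lam β γ).gibbsDensity N T x
        = T * (T⁻¹ * ∫ x, x.2 i ^ (k + 2) * (pinnedChain ω₂ lam β γ).gibbsDensity N T x) := by
          rw [← mul_assoc, mul_inv_cancel₀ hTne, one_mul]
      _ = T * ((k : ℝ) + 1) * ∫ x, x.2 i ^ k * (pinnedChain ω₂ lam β γ).gibbsDensity N T x := by
          rw [e2, mul_assoc]
  · have h := hint k
    refine (h.const_mul (((k + 1 : ℕ) : ℝ))).congr (Filter.Eventually.of_forall fun x => ?_)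
    simp only [Nat.add_sub_cancel]
    ring
  · have h := hint (k + 2)
    refine (h.const_mul (-T⁻¹)).congr (Filter.Eventually.of_forall fun x => ?_)
    simp only
    ring
  · exact hint (k + 1)

/-- **Even momentum moments are Gaussian**: `∫ p_i^{2j} e^{-H/T} ≤ (2j)! T^j ∫ e^{-H/T}` (in fact `= (2j-1)!! T^j Z`).
[folklore] -/
theorem pinnedChain_integral_momentum_even_pow_le (i : Fin N) (j : ℕ) :
    ∫ x, x.2 i ^ (2 * j) * (pinnedChain ω₂ lam β γ).gibbsDensity N T x ≤
      ((2 * j).factorial : ℝ) * T ^ j * ∫ x, (pinnedChain ω₂ lam β γ).gibbsDensity N T x := by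
  induction j with
  | zero => simp
  | succ j ih =>
    have hrec := pinnedChain_integral_momentum_pow_add_two_all hω hl hβ γ N hT i (2 * j)
    rw [show 2 * (j + 1) = 2 * j + 2 by ring, hrec]
    have hZ0 : 0 ≤ ∫ x, (pinnedChain ω₂ lam β γ).gibbsDensity N T x :=
      integral_nonneg fun x => ((pinnedChain ω₂ lam β γ).gibbsDensity_pos N T x).le
    have h1 : T * (2 * j + 1 : ℝ) * ∫ x, x.2 i ^ (2 * j) * (pinnedChain ω₂ lam β γ).gibbsDensity N T x ≤
        T * (2 * j + 1 : ℝ) * (((2 * j).factorial : ℝ) * T ^ j * ∫ x, (pinnedChain ω₂ lam β γ).gibbsDensity N T x) :=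
      mul_le_mul_of_nonneg_left ih (by positivity)
    have hcast : ((2 * j : ℕ) : ℝ) = 2 * (j : ℝ) := by push_cast; ring
    rw [hcast]
    refine h1.trans ?_
    have hfac : T * (2 * (j : ℝ) + 1) * (((2 * j).factorial : ℝ) * T ^ j) ≤ ((2 * j + 2).factorial : ℝ) * T ^ (j + 1) := by
      have e1 : ((2 * j + 2).factorial : ℝ) = (2 * j + 2) * ((2 * j + 1) * ((2 * j).factorial : ℝ)) := by
        rw [Nat.factorial_succ, Nat.factorial_succ]; push_cast; ring
      rw [e1, pow_succ]
      have hf0 : (0:ℝ) ≤ ((2 * j).factorial : ℝ) := by positivity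
      have hTj : 0 ≤ T ^ j := by positivity
      have hj0 : (0:ℝ) ≤ j := Nat.cast_nonneg j
      -- `T(2j+1)·f·T^j ≤ (2j+2)(2j+1) f T^j T` since `2j+2 ≥ 1`
      have : T * (2 * (j : ℝ) + 1) * (((2 * j).factorial : ℝ) * T ^ j) =
          1 * ((2 * (j : ℝ) + 1) * ((2 * j).factorial : ℝ)) * (T ^ j * T) := by ring
      rw [this]
      refine mul_le_mul_of_nonneg_right (mul_le_mul_of_nonneg_right (by linarith) (by positivity)) (by positivity)
    calc T * (2 * (j : ℝ) + 1) * (((2 * j).factorial : ℝ) * T ^ j * ∫ x, (pinnedChain ω₂ lam β γ).gibbsDensity N T x)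
        = (T * (2 * (j : ℝ) + 1) * (((2 * j).factorial : ℝ) * T ^ j)) * ∫ x, (pinnedChain ω₂ lam β γ).gibbsDensity N T x := by ring
      _ ≤ ((2 * j + 2).factorial : ℝ) * T ^ (j + 1) * ∫ x, (pinnedChain ω₂ lam β γ).gibbsDensity N T x :=
          mul_le_mul_of_nonneg_right hfac hZ0
      _ = _ := rfl

end Pinned

/-! ### Exponential one-site position moments (quartic pinning) -/

section ExpMoment

variable {ω₂ lam β : ℝ} (hω : 0 < ω₂) (hl : 0 < lam) (hβ : 0 ≤ β) (γ : ℝ) {T : ℝ} (hT : 0 < T)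
include hω hl hβ hT

omit hω hβ in
/-- `e^{κ a²} e^{-U(a)/T} ≤ e^{κ² T/lam} e^{-(ω₂/(2T)) a²}` for `U(a) = ω₂a²/2 + lam a⁴/4`, `lam, T > 0`: the quartic
pinning absorbs any Gaussian growth, since `κ a² - lam a⁴/(4T) - κ²T/lam = -(lam a² - 2Tκ)²/(4T lam) ≤ 0`.
[folklore] -/
theorem pinnedChain_exp_mul_sq_mul_exp_neg_U_le (κ a : ℝ) :
    Real.exp (κ * a ^ 2) * Real.exp (-(pinnedChain ω₂ lam β γ).U a / T) ≤
      Real.exp (κ ^ 2 * T / lam) * Real.exp (-(ω₂ / (2 * T)) * a ^ 2) := by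
  rw [← Real.exp_add, ← Real.exp_add]
  refine Real.exp_le_exp.2 ?_
  show κ * a ^ 2 + -(ω₂ * a ^ 2 / 2 + lam * a ^ 4 / 4) / T ≤ κ ^ 2 * T / lam + -(ω₂ / (2 * T)) * a ^ 2
  have e : κ * a ^ 2 + -(ω₂ * a ^ 2 / 2 + lam * a ^ 4 / 4) / T - (κ ^ 2 * T / lam + -(ω₂ / (2 * T)) * a ^ 2) =
      -((lam * a ^ 2 - 2 * T * κ) ^ 2) / (4 * T * lam) := by
    field_simp
    ring
  rw [← sub_nonpos, e]
  exact div_nonpos_of_nonpos_of_nonneg (neg_nonpos.2 (sq_nonneg _)) (by positivity)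

omit hβ in
/-- `∫ e^{κ a²} e^{-U(a)/T} da < ∞` for the quartic-pinned one-site weight (`ω₂, lam, T > 0`). [folklore] -/
theorem pinnedChain_lintegral_exp_mul_sq_mul_exp_neg_U_ne_top (κ : ℝ) :
    ∫⁻ a, ENNReal.ofReal (Real.exp (κ * a ^ 2)) *
        ENNReal.ofReal (Real.exp (-(pinnedChain ω₂ lam β γ).U a / T)) ≠ ⊤ := by
  have hb : 0 < ω₂ / (2 * T) := by positivity
  have hG : Integrable fun a : ℝ => Real.exp (κ ^ 2 * T / lam) * Real.exp (-(ω₂ / (2 * T)) * a ^ 2) :=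
    (integrable_exp_neg_mul_sq hb).const_mul _
  have hle : ∀ a, ENNReal.ofReal (Real.exp (κ * a ^ 2)) *
      ENNReal.ofReal (Real.exp (-(pinnedChain ω₂ lam β γ).U a / T)) ≤
      ENNReal.ofReal (Real.exp (κ ^ 2 * T / lam) * Real.exp (-(ω₂ / (2 * T)) * a ^ 2)) := fun a => by
    rw [← ENNReal.ofReal_mul (Real.exp_nonneg _)]
    exact ENNReal.ofReal_le_ofReal (pinnedChain_exp_mul_sq_mul_exp_neg_U_le hl γ hT κ a)
  exact ne_top_of_le_ne_top hG.lintegral_lt_top.ne (lintegral_mono hle)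

/-- **Exponential one-site position moments, uniformly in `N` and the site**: with `ρ = e^{-H/T}`,
`∫ e^{κ q_k²} ρ ≤ C_κ ∫ ρ` where `C_κ = ∫ e^{κa²} e^{-U(a)/T} da / ∫ e^{-U(a)/T} da` (finite by
`pinnedChain_lintegral_exp_mul_sq_mul_exp_neg_U_ne_top`), for every `κ ≥ 0`. [folklore] -/
theorem pinnedChain_lintegral_exp_mul_coord_sq_le (N : ℕ) (k : Fin N) {κ : ℝ} (hκ : 0 ≤ κ) :
    ∫⁻ x : PhaseSpace N, ENNReal.ofReal (Real.exp (κ * (x.1 k) ^ 2)) *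
        ENNReal.ofReal (Real.exp (-(pinnedChain ω₂ lam β γ).hamiltonian N x / T)) ≤
      ((∫⁻ a, ENNReal.ofReal (Real.exp (κ * a ^ 2)) *
            ENNReal.ofReal (Real.exp (-(pinnedChain ω₂ lam β γ).U a / T))) /
          ∫⁻ a, ENNReal.ofReal (Real.exp (-(pinnedChain ω₂ lam β γ).U a / T))) *
        ∫⁻ x : PhaseSpace N, ENNReal.ofReal (Real.exp (-(pinnedChain ω₂ lam β γ).hamiltonian N x / T)) := by
  set P := pinnedChain ω₂ lam β γ with hP
  set A := ∫⁻ a, ENNReal.ofReal (Real.exp (κ * a ^ 2)) * ENNReal.ofReal (Real.exp (-P.U a / T)) with hA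
  set ZU := ∫⁻ a, ENNReal.ofReal (Real.exp (-P.U a / T)) with hZU
  have hZU0 : ZU ≠ 0 := pinnedChain_lintegral_exp_neg_U_ne_zero ω₂ lam β γ T
  have hZUfin : ZU ≠ ⊤ := pinnedChain_lintegral_exp_neg_U_ne_top (β := β) hω hl.le γ hT
  have hh : Measurable fun a : ℝ => ENNReal.ofReal (Real.exp (κ * a ^ 2)) := by fun_prop
  have hhm : ∀ ⦃a b : ℝ⦄, |a| ≤ |b| →
      ENNReal.ofReal (Real.exp (κ * a ^ 2)) ≤ ENNReal.ofReal (Real.exp (κ * b ^ 2)) := fun a b hab =>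
    ENNReal.ofReal_le_ofReal (Real.exp_le_exp.2 (mul_le_mul_of_nonneg_left (sq_le_sq.2 hab) hκ))
  have key := pinnedChain_lintegral_coord_gibbsWeight_le hω hl.le hβ γ hT k hh hhm
  calc ∫⁻ x : PhaseSpace N, ENNReal.ofReal (Real.exp (κ * (x.1 k) ^ 2)) *
          ENNReal.ofReal (Real.exp (-P.hamiltonian N x / T))
        = (∫⁻ x : PhaseSpace N, ENNReal.ofReal (Real.exp (κ * (x.1 k) ^ 2)) *
            ENNReal.ofReal (Real.exp (-P.hamiltonian N x / T))) * ZU / ZU :=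
          (ENNReal.mul_div_cancel_right hZU0 hZUfin).symm
    _ ≤ (A * ∫⁻ x : PhaseSpace N, ENNReal.ofReal (Real.exp (-P.hamiltonian N x / T))) / ZU :=
          ENNReal.div_le_div_right key _
    _ = A / ZU * ∫⁻ x : PhaseSpace N, ENNReal.ofReal (Real.exp (-P.hamiltonian N x / T)) :=
          ENNReal.mul_div_right_comm

end ExpMoment

end Summit.AtomisticToContinuum.FouriersLaw.Theorems.ChainVariation

end
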